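import Literature.AlgebraicGeometry.ModuliOfAbelianVarieties.SiegelCanonicalModel
import Literature.AlgebraicGeometry.ShimuraVarieties.UnitaryAuxiliarySymplecticAdelic
import Literature.AlgebraicGeometry.ShimuraVarieties.UnitaryShimuraCanonicalModel
import Literature.AlgebraicGeometry.ShimuraVarieties.UnitaryAuxiliaryTorusReflexNorm
import Literature.NumberTheory.ComplexMultiplication.ReflexNormSwap
import HarnessLib

/-!
# The reciprocity element of a frame-diagonal CM structure is `ũ_β(d, t)` (S4b-1 of the I-1′ receptacle, T3 v4 `stub_S4`)

Topic `AlgebraicGeometry/ShimuraVarieties`; namespaces `Literature.AlgebraicGeometry.ModuliOfAbelianVarieties.CMStructure` (§1, generic)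
and `Literature.AlgebraicGeometry.ShimuraVarieties.UnitaryCanonicalModel.Aux` (§2–§4).  THEOREMS ONLY (no def, no fact, no instance;
net debt 0).  Cell hodgecm-mathlib (D-0151), fan B-III (T3) «Deligne 2.3.1 canonical model», B-plan2's line `F1ExtHodgeType` v4
«Q-ARCHITECTURE» on stmt-HodgeConjecture-24835 (`--supports`), stub `stub_S4 : S4Push` (owner A-p04 g7; this file = the SECOND's half
S4b-1 of A-p04's census `CENSUS-T3-S4-special-pair.A-p04.md` d1e3fa71 §1).

WHAT IS PROVED.  (σ4)-D ★ `CMStructure.cmRecipMatrix c Φ E s` ([Deligne1971TravauxShimura] 3.9/4.18; [Milne2005ShimuraVarieties] (60)–(62))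
is `c.cmRepMatrix (N_{E,Φᵢ}(s))ᵢ`, the tuple of reflex norms acting on `𝔸_{ℚ,f}^{2g}` through `act`.  §1 (generic, any CM structure):
`cmRepMatrix` is the value at `(e_{Kᵢ}⁻¹ tᵢ)ᵢ` of ANY `𝔸_{ℚ,f}`-linear map on `∏ᵢ 𝔸_{ℚ,f} ⊗_ℚ Kᵢ` that agrees with `act` (read in the
standard basis) on `∏ᵢ Kᵢ` — the bases `chooseBasis ℚ Kᵢ` of (σ4)-D only NAME the element (`cmRepMatrix_eq_of_linearMap`).  §2: for the
auxiliary datum of ★ `UnitaryAuxiliarySymplecticModule` (`W₀ ⊕ V_M = M^{1⊕3}`, symplectic frame `β`, ★ `auxRep`/`auxToGspFin`) and a CM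
structure INDEXED BY `Fin 1 ⊕ Fin 3` WITH ALL FIELDS `M` whose action is FRAME-DIAGONAL along an `M`-basis `B ∈ GL₃(M)` of `V_M`
(`actMatrix x = P · Res_{M/ℚ}(diag(x₀, B·diag(x₁,x₂,x₃)·B⁻¹)) · Q`, the hypothesis `hact` — A-p04's S4a-1 structure of an `H`-orthogonal
`L`-basis `b` has `B = b^j`), `cmRepMatrix y = P_𝔸 · Res(diag(z₀, B·diag(z₁,z₂,z₃)·B⁻¹)) · Q_𝔸` with `zᵢ = e_M⁻¹(yᵢ)`
(`cmRepMatrix_eq_frame`).  §3: a DIAGONAL TWIST `d` (★ `IsDiagTwist L H v₃ r d`: `d·v₃ = r·v₃`, `d = 1` on `v₃^⊥`) in an `H`-orthogonal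
`L`-basis `b = (v₁, v₂, v₃)` is `b·diag(1,1,r)·b⁻¹` over `𝔸_{L,f}`, hence `b^j·diag(1,1,r^j)·(b^j)⁻¹` in `GL₃(𝔸_{ℚ,f} ⊗ M)`
(`coe_unitaryToTensorFin_of_isDiagTwist`).  §4 (S4b-1): therefore the matrix of ★ `auxToGspFin F (d, t)` (`= β·diag(t, t·d^j)·β⁻¹`) IS
`c.cmRepMatrix (t, t, t, t·r^j)` (`coe_auxToGspFin_eq_cmRepMatrix`), and equals `c.cmRecipMatrix Φ′ E s` as soon as the four reflex norms
are `N_{E,Φ′ᵢ}(s) = t` (`i ≠ inr 2`) and `N_{E,Φ′_{inr 2}}(s) = t · r^j` (`coe_auxToGspFin_eq_cmRecipMatrix`) — the CM types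
`Φ′ = (Φ, Φ, Φ, Φ^τ̄)` and the reflex-norm identity `N_{E,Φ^τ̄}(s) = N_{E,Φ}(s) · (recipFactor (N_{E/L} s))^j` ([Milne2005ShimuraVarieties]
(60)–(61), `μ_x = [τ̄] − [τ]`) are A-p04's S4a-2 / S4b-2 and enter here only as the two hypotheses.  Nothing printed is asserted.
HC_CM is proved only modulo the 7 printed citations until rung 0 closes.

## References
* [Deligne1971TravauxShimura] P. Deligne, *Travaux de Shimura*, Sém. Bourbaki 389 (1971), 3.9 p. 140, 4.9 p. 147, 4.18 p. 150.
* [Milne2005ShimuraVarieties] J. S. Milne, *Introduction to Shimura varieties* (2005), Def. 12.5 p. 113, Def. 12.8 (60)–(62) p. 114, Ex. 12.4 (b) p. 112.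
* [Deligne1979ShimuraVarieties] P. Deligne, *Variétés de Shimura* (1979), Prop. 2.3.10 (the embedding `(u, z) ↦ (z, z·u)`).
* [CasselsFrohlichANT1967] Cassels–Fröhlich, Ch. II §14 Lemma (14.2) (`𝔸_{ℚ,f} ⊗_ℚ k ≅ 𝔸_{k,f}`).
-/

set_option autoImplicit false

noncomputable section

open Matrix NumberField IsDedekindDomain
open scoped TensorProduct

/-! ### §1. Generic: `cmRepMatrix` is the `𝔸_{ℚ,f}`-linear extension of `act` (the bases only name it) -/

namespace Literature.AlgebraicGeometry.ModuliOfAbelianVarieties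

open Literature.NumberTheory.ComplexMultiplication (ratFiniteAdeleTensorEquiv)

section Res

variable {R S : Type} [CommRing R] [CommRing S] [Algebra R S]
variable {κ : Type} [Fintype κ] [DecidableEq κ] {m : Type} [Fintype m] [DecidableEq m]

/-- Restriction of scalars along an `R`-basis is `R`-linear in the matrix: `Res(r·A) = r·Res(A)`.
[cite: Deligne1971TravauxShimura, 4.9 p. 147] -/
theorem resMatrix_smul (b : Module.Basis κ R S) (r : R) (A : Matrix m m S) :
    resMatrix (m := m) b (r • A) = r • resMatrix b A := by
  ext ⟨i, k⟩ ⟨i', l⟩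
  simp only [resMatrix_apply, Matrix.smul_apply, smul_mul_assoc, map_smul, Finsupp.smul_apply]

/-- Restriction of scalars commutes with the base change `S → R′ ⊗_R S`, `s ↦ 1 ⊗ s`, read in the bases `b` and `1 ⊗ b`.
[cite: Deligne1971TravauxShimura, 4.9 p. 147] -/
theorem resMatrix_map_includeRight (R' : Type) [CommRing R'] [Algebra R R'] (b : Module.Basis κ R S) (A : Matrix m m S) :
    (resMatrix (m := m) b A).map (algebraMap R R') =
      resMatrix (Algebra.TensorProduct.basis R' b)
        (A.map (Algebra.TensorProduct.includeRight : S →ₐ[R] R' ⊗[R] S)) := by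
  ext ⟨i, k⟩ ⟨i', l⟩
  rw [Matrix.map_apply, resMatrix_apply, resMatrix_apply, Matrix.map_apply, Algebra.TensorProduct.basis_apply,
    Algebra.TensorProduct.includeRight_apply, Algebra.TensorProduct.tmul_mul_tmul, one_mul,
    Algebra.TensorProduct.basis_repr_tmul, one_smul, Finsupp.mapRange_apply]

end Res

namespace CMStructure

variable {g : ℕ} {δ : Fin g → ℕ} {ι : Type} [Fintype ι] [DecidableEq ι] {K : ι → Type} [∀ i, Field (K i)]
  [∀ i, NumberField (K i)] [∀ i, IsCMField (K i)] (c : CMStructure g δ ι K)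

omit [Fintype ι] [∀ i, IsCMField (K i)] in
/-- `(1 ⊗ ·)` applied to a vector supported at one index is supported at that index. [folklore] -/
private theorem one_tmul_single (i : ι) (x : K i) :
    (fun i' => ((1 : finAdeleQ) ⊗ₜ[ℚ] (Pi.single (M := K) i x i') : finAdeleQ ⊗[ℚ] K i')) =
      Pi.single (M := fun i' => finAdeleQ ⊗[ℚ] K i') i ((1 : finAdeleQ) ⊗ₜ[ℚ] x) := by
  funext i'
  by_cases h : i' = i
  · subst h; simp
  · simp [Pi.single_eq_of_ne h]

/-- **`cmRepMatrix` is basis-free: it is the value at `(e_{Kᵢ}⁻¹ tᵢ)ᵢ` of ANY `𝔸_{ℚ,f}`-linear map on `∏ᵢ (𝔸_{ℚ,f} ⊗_ℚ Kᵢ)`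
extending `x ↦ actMatrix x` on `∏ᵢ Kᵢ`** (`e_{Kᵢ} = ` ★ `ratFiniteAdeleTensorEquiv (K i)`).  The chosen bases `chooseBasis ℚ Kᵢ` of
(σ4)-D's `adeleCoord`/`cmRepMatrix` only NAME the element ([Deligne1971TravauxShimura] 4.18: the torus `Res F^×` acting on `V ⊗ 𝔸_f`).
[cite: Deligne1971TravauxShimura, 3.9 p. 140 and 4.18 p. 150] [cite: CasselsFrohlichANT1967, Ch. II §14 Lemma (14.2)] -/
theorem cmRepMatrix_eq_of_linearMap
    (Θ : (Π i, finAdeleQ ⊗[ℚ] K i) →ₗ[finAdeleQ] Matrix (Fin g ⊕ Fin g) (Fin g ⊕ Fin g) finAdeleQ)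
    (hΘ : ∀ x : Π i, K i, Θ (fun i => (1 : finAdeleQ) ⊗ₜ[ℚ] x i) = (c.actMatrix x).map (algebraMap ℚ finAdeleQ))
    (t : Π i, FiniteAdeleRing (𝓞 (K i)) (K i)) :
    c.cmRepMatrix t = Θ (fun i => (ratFiniteAdeleTensorEquiv (K i)).symm (t i)) := by
  classical
  have hz : (fun i => (ratFiniteAdeleTensorEquiv (K i)).symm (t i)) =
      ∑ i, ∑ k, adeleCoord i (t i) k •
        Pi.single (M := fun i' => finAdeleQ ⊗[ℚ] K i') i
          ((1 : finAdeleQ) ⊗ₜ[ℚ] Module.Free.chooseBasis ℚ (K i) k) := by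
    rw [← Finset.univ_sum_single (fun i => (ratFiniteAdeleTensorEquiv (K i)).symm (t i))]
    refine Finset.sum_congr rfl fun i _ => ?_
    have hrepr := (Algebra.TensorProduct.basis finAdeleQ (Module.Free.chooseBasis ℚ (K i))).sum_repr
      ((ratFiniteAdeleTensorEquiv (K i)).symm (t i))
    have hsum : ∀ (f : Module.Free.ChooseBasisIndex ℚ (K i) → finAdeleQ ⊗[ℚ] K i),
        Pi.single (M := fun i' => finAdeleQ ⊗[ℚ] K i') i (∑ k, f k) =
          ∑ k, Pi.single (M := fun i' => finAdeleQ ⊗[ℚ] K i') i (f k) := fun f => by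
      simpa only [AddMonoidHom.single_apply] using
        map_sum (AddMonoidHom.single (fun i' => finAdeleQ ⊗[ℚ] K i') i) f Finset.univ
    conv_lhs => rw [← hrepr]
    rw [hsum]
    refine Finset.sum_congr rfl fun k _ => ?_
    rw [← Pi.single_smul, Algebra.TensorProduct.basis_apply]
    rfl
  rw [hz, map_sum]
  unfold cmRepMatrix
  refine Finset.sum_congr rfl fun i _ => ?_
  rw [map_sum]
  refine Finset.sum_congr rfl fun k _ => ?_
  rw [map_smul, ← one_tmul_single, hΘ]

end CMStructure

end Literature.AlgebraicGeometry.ModuliOfAbelianVarieties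

/-! ### §2. Frame-diagonal CM structures on `W₀ ⊕ V_M`: `cmRepMatrix` read in the symplectic frame -/

namespace Literature.AlgebraicGeometry.ShimuraVarieties

namespace UnitaryCanonicalModel

namespace Aux

open Literature.AlgebraicGeometry.ModuliOfAbelianVarieties
open Literature.NumberTheory.ComplexMultiplication (ratFiniteAdeleTensorEquiv ratFiniteAdeleTensorEquiv_tmul
  ratFiniteAdeleTensorEquiv_symm_algebraMap reflexNormFiniteIdele)
open Literature.AlgebraicGeometry.Motives (CMType)
open Literature.NumberTheory.Automorphic Literature.NumberTheory.Automorphic.UnitaryGroup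

section FrameDiag

variable {R S : Type} [CommRing R] [CommRing S] [Algebra R S]

/-- The frame-diagonal matrix `diag(z₀, B·diag(z₁,z₂,z₃)·B′)` is additive in `z`. [folklore] -/
private theorem frameDiag_add (B B' : Matrix (Fin 3) (Fin 3) S) (z z' : (Fin 1 ⊕ Fin 3) → S) :
    Matrix.fromBlocks (Matrix.diagonal fun _ : Fin 1 => (z + z') (Sum.inl 0)) 0 0
        (B * Matrix.diagonal (fun k => (z + z') (Sum.inr k)) * B') =
      Matrix.fromBlocks (Matrix.diagonal fun _ : Fin 1 => z (Sum.inl 0)) 0 0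
          (B * Matrix.diagonal (fun k => z (Sum.inr k)) * B') +
        Matrix.fromBlocks (Matrix.diagonal fun _ : Fin 1 => z' (Sum.inl 0)) 0 0
          (B * Matrix.diagonal (fun k => z' (Sum.inr k)) * B') := by
  rw [Matrix.fromBlocks_add, add_zero, add_zero, Matrix.diagonal_add, ← Matrix.add_mul, ← Matrix.mul_add,
    Matrix.diagonal_add]
  rfl

/-- The frame-diagonal matrix is `R`-homogeneous in `z`. [folklore] -/
private theorem frameDiag_smul (B B' : Matrix (Fin 3) (Fin 3) S) (r : R) (z : (Fin 1 ⊕ Fin 3) → S) :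
    Matrix.fromBlocks (Matrix.diagonal fun _ : Fin 1 => (r • z) (Sum.inl 0)) 0 0
        (B * Matrix.diagonal (fun k => (r • z) (Sum.inr k)) * B') =
      r • Matrix.fromBlocks (Matrix.diagonal fun _ : Fin 1 => z (Sum.inl 0)) 0 0
          (B * Matrix.diagonal (fun k => z (Sum.inr k)) * B') := by
  rw [Matrix.fromBlocks_smul, smul_zero, smul_zero]
  have h1 : (Matrix.diagonal fun _ : Fin 1 => (r • z) (Sum.inl 0)) = r • Matrix.diagonal fun _ : Fin 1 => z (Sum.inl 0) := by
    rw [← Matrix.diagonal_smul]; rfl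
  have h2 : (Matrix.diagonal fun k => (r • z) (Sum.inr k)) = r • Matrix.diagonal fun k => z (Sum.inr k) := by
    rw [← Matrix.diagonal_smul]; rfl
  rw [h1, h2, Matrix.mul_smul, Matrix.smul_mul]

/-- The frame-diagonal matrix commutes with entrywise ring homomorphisms. [folklore] -/
private theorem frameDiag_map {S' : Type} [CommRing S'] (f : S →+* S') (B B' : Matrix (Fin 3) (Fin 3) S)
    (z : (Fin 1 ⊕ Fin 3) → S) :
    (Matrix.fromBlocks (Matrix.diagonal fun _ : Fin 1 => z (Sum.inl 0)) 0 0
        (B * Matrix.diagonal (fun k => z (Sum.inr k)) * B')).map f =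
      Matrix.fromBlocks (Matrix.diagonal fun _ : Fin 1 => f (z (Sum.inl 0))) 0 0
        (B.map f * Matrix.diagonal (fun k => f (z (Sum.inr k))) * B'.map f) := by
  rw [Matrix.fromBlocks_map, Matrix.diagonal_map (map_zero f), Matrix.map_zero f (map_zero f),
    Matrix.map_zero f (map_zero f), Matrix.map_mul, Matrix.map_mul, Matrix.diagonal_map (map_zero f)]

end FrameDiag

section Frame

variable {L : Type} [Field L] [NumberField L] [IsCMField L] {M : Type} [Field M] [NumberField M] [IsCMField M]
  {j : L →+* M} {H : Matrix (Fin 3) (Fin 3) L} {ξ₀ ξ : M} {g : ℕ} {δ : Fin g → ℕ}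

omit [NumberField L] [IsCMField L] in
/-- **`cmRepMatrix` of a FRAME-DIAGONAL CM structure, read in the symplectic frame.**  Let `c` be a CM structure of type `δ` on
`ℚ^{2g}` indexed by `Fin 1 ⊕ Fin 3` with all fields `M` ([Deligne1971TravauxShimura] 4.18 with `F = M⁴` acting on `W₀ ⊕ V_M = M^{1⊕3}`)
whose action, read in the standard basis, is `β`-conjugate to the `M`-DIAGONAL action along an `M`-basis `B ∈ GL₃(M)` of `V_M`:
`actMatrix x = P · Res_{M/ℚ}(diag(x₀, B·diag(x₁,x₂,x₃)·B⁻¹)) · Q` (`hact`; `P, Q` = ★ `frameP/frameQ`, `Res` = ★ `resMatrix` along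
★ `ratBasis M`).  Then for every `y ∈ 𝔸_{M,f}^{1⊕3}` the matrix `cmRepMatrix c y` on `𝔸_{ℚ,f}^{2g}` is the SAME expression over
`𝔸_{ℚ,f} ⊗_ℚ M` at `zᵢ = e_M⁻¹(yᵢ)`: `P_𝔸 · Res(diag(z₀, B·diag(z₁,z₂,z₃)·B⁻¹)) · Q_𝔸` — by §1 (`cmRepMatrix_eq_of_linearMap`), the right-hand
side being `𝔸_{ℚ,f}`-linear in `z` and equal to `(actMatrix x) ⊗ 1` at `z = 1 ⊗ x`.
[cite: Deligne1971TravauxShimura, 4.9 p. 147 and 4.18 p. 150] [cite: Deligne1979ShimuraVarieties, Prop. 2.3.10] -/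
theorem cmRepMatrix_eq_frame (F : SymplecticFrame M j H ξ₀ ξ g δ) (B : GL (Fin 3) M)
    (c : CMStructure g δ (Fin 1 ⊕ Fin 3) (fun _ => M))
    (hact : ∀ x : (Fin 1 ⊕ Fin 3) → M, c.actMatrix x =
      frameP F * resMatrix (ratBasis M)
        (Matrix.fromBlocks (Matrix.diagonal fun _ : Fin 1 => x (Sum.inl 0)) 0 0
          ((B : Matrix (Fin 3) (Fin 3) M) * Matrix.diagonal (fun k => x (Sum.inr k)) *
            ((B⁻¹ : GL (Fin 3) M) : Matrix (Fin 3) (Fin 3) M))) * frameQ F)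
    (y : (Fin 1 ⊕ Fin 3) → FiniteAdeleRing (𝓞 M) M) :
    c.cmRepMatrix y =
      framePR finAdeleQ F *
        resMatrix (Algebra.TensorProduct.basis finAdeleQ (ratBasis M))
          (Matrix.fromBlocks
            (Matrix.diagonal fun _ : Fin 1 => (ratFiniteAdeleTensorEquiv M).symm (y (Sum.inl 0))) 0 0
            (((B : Matrix (Fin 3) (Fin 3) M).map
                (Algebra.TensorProduct.includeRight : M →ₐ[ℚ] finAdeleQ ⊗[ℚ] M)) *
              Matrix.diagonal (fun k => (ratFiniteAdeleTensorEquiv M).symm (y (Sum.inr k))) *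
              (((B⁻¹ : GL (Fin 3) M) : Matrix (Fin 3) (Fin 3) M).map
                (Algebra.TensorProduct.includeRight : M →ₐ[ℚ] finAdeleQ ⊗[ℚ] M)))) *
        frameQR finAdeleQ F := by
  -- the right-hand side as an `𝔸_{ℚ,f}`-linear map of `z ∈ (𝔸_{ℚ,f} ⊗ M)^{1⊕3}`
  let BR : Matrix (Fin 3) (Fin 3) (finAdeleQ ⊗[ℚ] M) :=
    (B : Matrix (Fin 3) (Fin 3) M).map (Algebra.TensorProduct.includeRight : M →ₐ[ℚ] finAdeleQ ⊗[ℚ] M)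
  let BR' : Matrix (Fin 3) (Fin 3) (finAdeleQ ⊗[ℚ] M) :=
    ((B⁻¹ : GL (Fin 3) M) : Matrix (Fin 3) (Fin 3) M).map (Algebra.TensorProduct.includeRight : M →ₐ[ℚ] finAdeleQ ⊗[ℚ] M)
  let Θ : ((Fin 1 ⊕ Fin 3) → finAdeleQ ⊗[ℚ] M) →ₗ[finAdeleQ] Matrix (Fin g ⊕ Fin g) (Fin g ⊕ Fin g) finAdeleQ :=
    { toFun := fun z =>
        framePR finAdeleQ F *
          resMatrix (Algebra.TensorProduct.basis finAdeleQ (ratBasis M))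
            (Matrix.fromBlocks (Matrix.diagonal fun _ : Fin 1 => z (Sum.inl 0)) 0 0
              (BR * Matrix.diagonal (fun k => z (Sum.inr k)) * BR')) *
          frameQR finAdeleQ F
      map_add' := fun z z' => by
        rw [frameDiag_add, map_add, Matrix.mul_add, Matrix.add_mul]
      map_smul' := fun r z => by
        simp only [RingHom.id_apply]
        rw [frameDiag_smul, resMatrix_smul, Matrix.mul_smul, Matrix.smul_mul] }
  have hΘ : ∀ x : (Fin 1 ⊕ Fin 3) → M,
      Θ (fun i => (1 : finAdeleQ) ⊗ₜ[ℚ] x i) = (c.actMatrix x).map (algebraMap ℚ finAdeleQ) := by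
    intro x
    have hcoe : (⇑(Algebra.TensorProduct.includeRight : M →ₐ[ℚ] finAdeleQ ⊗[ℚ] M)) =
        ⇑((Algebra.TensorProduct.includeRight : M →ₐ[ℚ] finAdeleQ ⊗[ℚ] M).toRingHom) := rfl
    rw [hact, Matrix.map_mul, Matrix.map_mul, resMatrix_map_includeRight finAdeleQ (ratBasis M), hcoe,
      frameDiag_map]
    rfl
  exact c.cmRepMatrix_eq_of_linearMap Θ hΘ y

end Frame

/-! ### §3. A diagonal twist in an `H`-orthogonal `L`-basis: `d = b·diag(1,1,r)·b⁻¹`, hence `d^j = b^j·diag(1,1,r^j)·(b^j)⁻¹` -/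

section DiagTwist

variable {L : Type} [Field L] [NumberField L] [IsCMField L] (M : Type) [Field M] [NumberField M] [IsCMField M]
  (j : L →+* M) (H : Matrix (Fin 3) (Fin 3) L)

omit [IsCMField M] in
/-- Underlying matrix of the transport `U(H)(𝔸_f) → GL₃(𝔸_{ℚ,f} ⊗_ℚ M)`: entrywise `finAdeleToTensor M j`.
[cite: Deligne1979ShimuraVarieties, Prop. 2.3.10] -/
theorem coe_unitaryToTensorFin (d : ↥(finAdelic (↥(maximalRealSubfield L)) L (IsCMField.complexConj L) 3 H)) :
    ((unitaryToTensorFin M j H d : GL (Fin 3) (finAdeleQ ⊗[ℚ] M)) : Matrix (Fin 3) (Fin 3) (finAdeleQ ⊗[ℚ] M)) =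
      (((d : GL (Fin 3) (FiniteAdeleRing (𝓞 L) L)) : Matrix (Fin 3) (Fin 3) (FiniteAdeleRing (𝓞 L) L))).map
        (finAdeleToTensor M j) := rfl

variable {M j H}

/-- **A diagonal twist in an `H`-orthogonal `L`-basis** ([Milne2005ShimuraVarieties] Def. 12.5: «`d = diag_b(1,1,r)` in every
orthogonal basis `b = (v₁,v₂,v₃)`»): if the columns `v₁, v₂, v₃` of `b ∈ GL₃(L)` have `v₁, v₂ ⟂_H v₃` and `d` is a diagonal twist at
`v₃` with eigenvalue `r` (★ `IsDiagTwist L H v₃ r d`), then `d · b = b · diag(1, 1, r)` over `𝔸_{L,f}`.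
[cite: Milne2005ShimuraVarieties, Def. 12.5 p. 113] -/
theorem coe_mul_basis_of_isDiagTwist (b : GL (Fin 3) L)
    (h0 : hermForm (cmConjRingHom L) H (fun i => (b : Matrix (Fin 3) (Fin 3) L) i 0)
      (fun i => (b : Matrix (Fin 3) (Fin 3) L) i 2) = 0)
    (h1 : hermForm (cmConjRingHom L) H (fun i => (b : Matrix (Fin 3) (Fin 3) L) i 1)
      (fun i => (b : Matrix (Fin 3) (Fin 3) L) i 2) = 0)
    (r : FiniteAdeleRing (𝓞 L) L) (d : ↥(finAdelic (↥(maximalRealSubfield L)) L (IsCMField.complexConj L) 3 H))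
    (hd : IsDiagTwist L H (fun i => (b : Matrix (Fin 3) (Fin 3) L) i 2) r d) :
    (((d : GL (Fin 3) (FiniteAdeleRing (𝓞 L) L)) : Matrix (Fin 3) (Fin 3) (FiniteAdeleRing (𝓞 L) L))) *
        (b : Matrix (Fin 3) (Fin 3) L).map (algebraMap L (FiniteAdeleRing (𝓞 L) L)) =
      (b : Matrix (Fin 3) (Fin 3) L).map (algebraMap L (FiniteAdeleRing (𝓞 L) L)) * Matrix.diagonal ![1, 1, r] := by
  -- column `k` of `d · b` is `d *ᵥ adelicVec v_k`, and the twist is diagonal on the `v_k`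
  have hcol : ∀ k : Fin 3,
      (((d : GL (Fin 3) (FiniteAdeleRing (𝓞 L) L)) : Matrix (Fin 3) (Fin 3) (FiniteAdeleRing (𝓞 L) L))) *ᵥ
          adelicVec L (fun i => (b : Matrix (Fin 3) (Fin 3) L) i k) =
        (![1, 1, r] : Fin 3 → FiniteAdeleRing (𝓞 L) L) k • adelicVec L (fun i => (b : Matrix (Fin 3) (Fin 3) L) i k) := by
    intro k
    fin_cases k
    · simpa using hd.2 _ h0
    · simpa using hd.2 _ h1
    · simpa using hd.1
  apply Matrix.ext
  intro i k
  -- the `(i, k)` entry of `d · b` is the `i`-th component of `d *ᵥ adelicVec v_k`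
  have hk : ((((d : GL (Fin 3) (FiniteAdeleRing (𝓞 L) L)) : Matrix (Fin 3) (Fin 3) (FiniteAdeleRing (𝓞 L) L))) *
        (b : Matrix (Fin 3) (Fin 3) L).map (algebraMap L (FiniteAdeleRing (𝓞 L) L))) i k =
      ((((d : GL (Fin 3) (FiniteAdeleRing (𝓞 L) L)) : Matrix (Fin 3) (Fin 3) (FiniteAdeleRing (𝓞 L) L))) *ᵥ
        adelicVec L (fun i => (b : Matrix (Fin 3) (Fin 3) L) i k)) i := rfl
  rw [hk, Matrix.mul_diagonal, Matrix.map_apply, hcol k, Pi.smul_apply, smul_eq_mul, mul_comm]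
  rfl

/-- Hence `d = b · diag(1,1,r) · b⁻¹` in `M₃(𝔸_{L,f})`. [cite: Milne2005ShimuraVarieties, Def. 12.5 p. 113] -/
theorem coe_eq_conj_diagonal_of_isDiagTwist (b : GL (Fin 3) L)
    (h0 : hermForm (cmConjRingHom L) H (fun i => (b : Matrix (Fin 3) (Fin 3) L) i 0)
      (fun i => (b : Matrix (Fin 3) (Fin 3) L) i 2) = 0)
    (h1 : hermForm (cmConjRingHom L) H (fun i => (b : Matrix (Fin 3) (Fin 3) L) i 1)
      (fun i => (b : Matrix (Fin 3) (Fin 3) L) i 2) = 0)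
    (r : FiniteAdeleRing (𝓞 L) L) (d : ↥(finAdelic (↥(maximalRealSubfield L)) L (IsCMField.complexConj L) 3 H))
    (hd : IsDiagTwist L H (fun i => (b : Matrix (Fin 3) (Fin 3) L) i 2) r d) :
    (((d : GL (Fin 3) (FiniteAdeleRing (𝓞 L) L)) : Matrix (Fin 3) (Fin 3) (FiniteAdeleRing (𝓞 L) L))) =
      ((Matrix.GeneralLinearGroup.map (algebraMap L (FiniteAdeleRing (𝓞 L) L)) b : GL (Fin 3) (FiniteAdeleRing (𝓞 L) L)) :
          Matrix (Fin 3) (Fin 3) (FiniteAdeleRing (𝓞 L) L)) * Matrix.diagonal ![1, 1, r] *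
        (((Matrix.GeneralLinearGroup.map (algebraMap L (FiniteAdeleRing (𝓞 L) L)) b)⁻¹ :
            GL (Fin 3) (FiniteAdeleRing (𝓞 L) L)) : Matrix (Fin 3) (Fin 3) (FiniteAdeleRing (𝓞 L) L)) := by
  set bA : GL (Fin 3) (FiniteAdeleRing (𝓞 L) L) := Matrix.GeneralLinearGroup.map (algebraMap L (FiniteAdeleRing (𝓞 L) L)) b
  have hbA : ((bA : GL (Fin 3) (FiniteAdeleRing (𝓞 L) L)) : Matrix (Fin 3) (Fin 3) (FiniteAdeleRing (𝓞 L) L)) =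
      (b : Matrix (Fin 3) (Fin 3) L).map (algebraMap L (FiniteAdeleRing (𝓞 L) L)) := rfl
  have hmul := coe_mul_basis_of_isDiagTwist b h0 h1 r d hd
  rw [← hbA] at hmul
  calc (((d : GL (Fin 3) (FiniteAdeleRing (𝓞 L) L)) : Matrix (Fin 3) (Fin 3) (FiniteAdeleRing (𝓞 L) L)))
      = (((d : GL (Fin 3) (FiniteAdeleRing (𝓞 L) L)) : Matrix (Fin 3) (Fin 3) (FiniteAdeleRing (𝓞 L) L))) *
          ((bA : Matrix (Fin 3) (Fin 3) (FiniteAdeleRing (𝓞 L) L)) *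
            ((bA⁻¹ : GL (Fin 3) (FiniteAdeleRing (𝓞 L) L)) : Matrix (Fin 3) (Fin 3) (FiniteAdeleRing (𝓞 L) L))) := by
        rw [← Units.val_mul, mul_inv_cancel, Units.val_one, Matrix.mul_one]
    _ = (bA : Matrix (Fin 3) (Fin 3) (FiniteAdeleRing (𝓞 L) L)) * Matrix.diagonal ![1, 1, r] *
          ((bA⁻¹ : GL (Fin 3) (FiniteAdeleRing (𝓞 L) L)) : Matrix (Fin 3) (Fin 3) (FiniteAdeleRing (𝓞 L) L)) := by
        rw [← Matrix.mul_assoc, hmul]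

omit [IsCMField M] in
/-- **The transported twist is frame-diagonal in the basis `b^j`**: with `B := b^j ∈ GL₃(M)` (entrywise `j`),
`d^j = B·diag(1, 1, r^j)·B⁻¹` in `GL₃(𝔸_{ℚ,f} ⊗_ℚ M)`, `r^j = finAdeleToTensor M j r`, `B` read through `1 ⊗ ·`.
[cite: Milne2005ShimuraVarieties, Def. 12.5 p. 113] [cite: Deligne1979ShimuraVarieties, Prop. 2.3.10] -/
theorem coe_unitaryToTensorFin_of_isDiagTwist (b : GL (Fin 3) L)
    (h0 : hermForm (cmConjRingHom L) H (fun i => (b : Matrix (Fin 3) (Fin 3) L) i 0)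
      (fun i => (b : Matrix (Fin 3) (Fin 3) L) i 2) = 0)
    (h1 : hermForm (cmConjRingHom L) H (fun i => (b : Matrix (Fin 3) (Fin 3) L) i 1)
      (fun i => (b : Matrix (Fin 3) (Fin 3) L) i 2) = 0)
    (r : FiniteAdeleRing (𝓞 L) L) (d : ↥(finAdelic (↥(maximalRealSubfield L)) L (IsCMField.complexConj L) 3 H))
    (hd : IsDiagTwist L H (fun i => (b : Matrix (Fin 3) (Fin 3) L) i 2) r d) :
    ((unitaryToTensorFin M j H d : GL (Fin 3) (finAdeleQ ⊗[ℚ] M)) : Matrix (Fin 3) (Fin 3) (finAdeleQ ⊗[ℚ] M)) =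
      ((Matrix.GeneralLinearGroup.map (j : L →+* M) b : GL (Fin 3) M) : Matrix (Fin 3) (Fin 3) M).map
          (Algebra.TensorProduct.includeRight : M →ₐ[ℚ] finAdeleQ ⊗[ℚ] M) *
        Matrix.diagonal ![1, 1, finAdeleToTensor M j r] *
        (((Matrix.GeneralLinearGroup.map (j : L →+* M) b)⁻¹ : GL (Fin 3) M) : Matrix (Fin 3) (Fin 3) M).map
          (Algebra.TensorProduct.includeRight : M →ₐ[ℚ] finAdeleQ ⊗[ℚ] M) := by
  have hB : ∀ b' : GL (Fin 3) L,
      (((Matrix.GeneralLinearGroup.map (algebraMap L (FiniteAdeleRing (𝓞 L) L)) b' : GL (Fin 3) (FiniteAdeleRing (𝓞 L) L)) :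
          Matrix (Fin 3) (Fin 3) (FiniteAdeleRing (𝓞 L) L))).map (finAdeleToTensor M j) =
        ((Matrix.GeneralLinearGroup.map (j : L →+* M) b' : GL (Fin 3) M) : Matrix (Fin 3) (Fin 3) M).map
          (Algebra.TensorProduct.includeRight : M →ₐ[ℚ] finAdeleQ ⊗[ℚ] M) := by
    intro b'
    ext i k
    change finAdeleToTensor M j (algebraMap L (FiniteAdeleRing (𝓞 L) L) ((b' : Matrix (Fin 3) (Fin 3) L) i k)) =
      (1 : finAdeleQ) ⊗ₜ[ℚ] j ((b' : Matrix (Fin 3) (Fin 3) L) i k)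
    exact finAdeleToTensor_algebraMap M j _
  have hv : (fun m => finAdeleToTensor M j ((![1, 1, r] : Fin 3 → FiniteAdeleRing (𝓞 L) L) m)) =
      ![1, 1, finAdeleToTensor M j r] := by
    funext k
    fin_cases k <;> simp
  rw [coe_unitaryToTensorFin, coe_eq_conj_diagonal_of_isDiagTwist b h0 h1 r d hd, Matrix.map_mul, Matrix.map_mul,
    hB b, ← map_inv, ← map_inv, hB b⁻¹, Matrix.diagonal_map (map_zero _), hv]

end DiagTwist

/-! ### §4. S4b-1: the matrix of `ũ_β(d, t)` IS the reciprocity element of the frame-diagonal CM structure -/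

section Recip

variable {L : Type} [Field L] [NumberField L] [IsCMField L] {M : Type} [Field M] [NumberField M] [IsCMField M]
  {j : L →+* M} {H : Matrix (Fin 3) (Fin 3) L} {ξ₀ ξ : M} {g : ℕ} {δ : Fin g → ℕ}

/-- **S4b-1 (matrix bookkeeping of the reciprocity datum).**  Let `F` be a symplectic frame of `W₀ ⊕ V_M`, `b ∈ GL₃(L)` an
`H`-orthogonal `L`-basis (columns `v₁, v₂ ⟂_H v₃`), `c` a CM structure indexed by `Fin 1 ⊕ Fin 3` with all fields `M` which is
FRAME-DIAGONAL along `B = b^j` (`hact`, A-p04's S4a-1 structure of the line point `[v₃]`), `d` a diagonal twist at `v₃` with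
eigenvalue `r` (★ `IsDiagTwist`) and `t ∈ T₀(M)(𝔸_f)`.  Then the matrix of ★ `auxToGspFin F (d, t) = β·diag(t, t·d^j)·β⁻¹ ∈ GSp_δ(𝔸_{ℚ,f})`
is `c.cmRepMatrix y` for the tuple `y = (t, t, t, t·r^j) ∈ 𝔸_{M,f}^{1⊕3}` (`r^j = e_M(finAdeleToTensor M j r)`): the torus acts by `t`
on `W₀`, `M·v₁`, `M·v₂` and by `t·r^j` on the line `M·v₃` — [Milne2005ShimuraVarieties] (62) `r(s) = (N_Φ(s); d)` read through the
embedding `ũ` of [Deligne1979ShimuraVarieties] 2.3.10.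
[cite: Milne2005ShimuraVarieties, Def. 12.5 p. 113 and Def. 12.8 (62) p. 114] [cite: Deligne1979ShimuraVarieties, Prop. 2.3.10]
[cite: Deligne1971TravauxShimura, 4.18 p. 150] -/
theorem coe_auxToGspFin_eq_cmRepMatrix (F : SymplecticFrame M j H ξ₀ ξ g δ) (b : GL (Fin 3) L)
    (h0 : hermForm (cmConjRingHom L) H (fun i => (b : Matrix (Fin 3) (Fin 3) L) i 0)
      (fun i => (b : Matrix (Fin 3) (Fin 3) L) i 2) = 0)
    (h1 : hermForm (cmConjRingHom L) H (fun i => (b : Matrix (Fin 3) (Fin 3) L) i 1)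
      (fun i => (b : Matrix (Fin 3) (Fin 3) L) i 2) = 0)
    (c : CMStructure g δ (Fin 1 ⊕ Fin 3) (fun _ => M))
    (hact : ∀ x : (Fin 1 ⊕ Fin 3) → M, c.actMatrix x =
      frameP F * resMatrix (ratBasis M)
        (Matrix.fromBlocks (Matrix.diagonal fun _ : Fin 1 => x (Sum.inl 0)) 0 0
          (((Matrix.GeneralLinearGroup.map (j : L →+* M) b : GL (Fin 3) M) : Matrix (Fin 3) (Fin 3) M) *
            Matrix.diagonal (fun k => x (Sum.inr k)) *
            (((Matrix.GeneralLinearGroup.map (j : L →+* M) b)⁻¹ : GL (Fin 3) M) : Matrix (Fin 3) (Fin 3) M))) *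
        frameQ F)
    (r : FiniteAdeleRing (𝓞 L) L) (d : ↥(finAdelic (↥(maximalRealSubfield L)) L (IsCMField.complexConj L) 3 H))
    (hd : IsDiagTwist L H (fun i => (b : Matrix (Fin 3) (Fin 3) L) i 2) r d) (t : ↥(torusFinAdelic M))
    (y : (Fin 1 ⊕ Fin 3) → FiniteAdeleRing (𝓞 M) M)
    (hy₀ : y (Sum.inl 0) = ((t : (FiniteAdeleRing (𝓞 M) M)ˣ) : FiniteAdeleRing (𝓞 M) M))
    (hy₁ : y (Sum.inr 0) = ((t : (FiniteAdeleRing (𝓞 M) M)ˣ) : FiniteAdeleRing (𝓞 M) M))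
    (hy₂ : y (Sum.inr 1) = ((t : (FiniteAdeleRing (𝓞 M) M)ˣ) : FiniteAdeleRing (𝓞 M) M))
    (hy₃ : y (Sum.inr 2) = ((t : (FiniteAdeleRing (𝓞 M) M)ˣ) : FiniteAdeleRing (𝓞 M) M) *
      ratFiniteAdeleTensorEquiv M (finAdeleToTensor M j r)) :
    ((auxToGspFin F (d, t) : GL (Fin g ⊕ Fin g) finAdeleQ) : Matrix (Fin g ⊕ Fin g) (Fin g ⊕ Fin g) finAdeleQ) =
      c.cmRepMatrix y := by
  rw [cmRepMatrix_eq_frame F (Matrix.GeneralLinearGroup.map (j : L →+* M) b) c hact y, coe_auxToGspFin, auxRep,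
    MonoidHom.comp_apply, MonoidHom.comp_apply, coe_conjRect, coe_resGL, coe_blockGL,
    coe_unitaryToTensorFin_of_isDiagTwist b h0 h1 r d hd]
  have ht : (torusToTensorFin M t : finAdeleQ ⊗[ℚ] M) =
      (ratFiniteAdeleTensorEquiv M).symm ((t : (FiniteAdeleRing (𝓞 M) M)ˣ) : FiniteAdeleRing (𝓞 M) M) := rfl
  congr 2
  have hdiag : (fun k => (ratFiniteAdeleTensorEquiv M).symm (y (Sum.inr k))) =
      (torusToTensorFin M t : finAdeleQ ⊗[ℚ] M) • ![1, 1, finAdeleToTensor M j r] := by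
    funext k
    fin_cases k
    · simp [hy₁, ht]
    · simp [hy₂, ht]
    · simp [hy₃, ht, map_mul]
  rw [Matrix.smul_one_eq_diagonal, hy₀, hdiag, Matrix.diagonal_smul, Matrix.mul_smul, Matrix.smul_mul, ← ht]

/-- **S4b-1, reciprocity form.**  Under the hypotheses of `coe_auxToGspFin_eq_cmRepMatrix`, if the CM types `Φ′` of the special pair
have reflex norms `N_{E,Φ′ᵢ}(s) = t` for `i ≠ inr 2` and `N_{E,Φ′_{inr 2}}(s) = t · r^j` (A-p04's S4a-2: `Φ′ = (Φ, Φ, Φ, Φ^τ̄)`, and S4b-2: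
`N_{E,Φ^τ̄}(s) = N_{E,Φ}(s)·(recipFactor (N_{E/L} s))^j`, [Milne2005ShimuraVarieties] (60)–(61) with `μ_x = [τ̄] − [τ]`), then the
reciprocity element of (σ4)-D ★ `IsCanonical` IS the matrix of `ũ_β(d, t)`: `c.cmRecipMatrix Φ′ E s = ũ_β(d, t)`.
[cite: Milne2005ShimuraVarieties, Def. 12.8 (60)–(62) p. 114, Ex. 12.4 (b) p. 112] [cite: Deligne1971TravauxShimura, 3.9 p. 140, 4.18 p. 150] -/
theorem coe_auxToGspFin_eq_cmRecipMatrix (F : SymplecticFrame M j H ξ₀ ξ g δ) (b : GL (Fin 3) L)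
    (h0 : hermForm (cmConjRingHom L) H (fun i => (b : Matrix (Fin 3) (Fin 3) L) i 0)
      (fun i => (b : Matrix (Fin 3) (Fin 3) L) i 2) = 0)
    (h1 : hermForm (cmConjRingHom L) H (fun i => (b : Matrix (Fin 3) (Fin 3) L) i 1)
      (fun i => (b : Matrix (Fin 3) (Fin 3) L) i 2) = 0)
    (c : CMStructure g δ (Fin 1 ⊕ Fin 3) (fun _ => M))
    (hact : ∀ x : (Fin 1 ⊕ Fin 3) → M, c.actMatrix x =
      frameP F * resMatrix (ratBasis M)
        (Matrix.fromBlocks (Matrix.diagonal fun _ : Fin 1 => x (Sum.inl 0)) 0 0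
          (((Matrix.GeneralLinearGroup.map (j : L →+* M) b : GL (Fin 3) M) : Matrix (Fin 3) (Fin 3) M) *
            Matrix.diagonal (fun k => x (Sum.inr k)) *
            (((Matrix.GeneralLinearGroup.map (j : L →+* M) b)⁻¹ : GL (Fin 3) M) : Matrix (Fin 3) (Fin 3) M))) *
        frameQ F)
    (r : FiniteAdeleRing (𝓞 L) L) (d : ↥(finAdelic (↥(maximalRealSubfield L)) L (IsCMField.complexConj L) 3 H))
    (hd : IsDiagTwist L H (fun i => (b : Matrix (Fin 3) (Fin 3) L) i 2) r d) (t : ↥(torusFinAdelic M))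
    (Φ' : (Fin 1 ⊕ Fin 3) → CMType M) (E : IntermediateField ℚ ℂ) [NumberField ↥E] (s : (FiniteAdeleRing (𝓞 ↥E) ↥E)ˣ)
    (hN : ∀ i : Fin 1 ⊕ Fin 3, i ≠ Sum.inr 2 →
      ((reflexNormFiniteIdele M (Φ' i) E s : (FiniteAdeleRing (𝓞 M) M)ˣ) : FiniteAdeleRing (𝓞 M) M) =
        ((t : (FiniteAdeleRing (𝓞 M) M)ˣ) : FiniteAdeleRing (𝓞 M) M))
    (hN₂ : ((reflexNormFiniteIdele M (Φ' (Sum.inr 2)) E s : (FiniteAdeleRing (𝓞 M) M)ˣ) : FiniteAdeleRing (𝓞 M) M) =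
      ((t : (FiniteAdeleRing (𝓞 M) M)ˣ) : FiniteAdeleRing (𝓞 M) M) * ratFiniteAdeleTensorEquiv M (finAdeleToTensor M j r)) :
    ((auxToGspFin F (d, t) : GL (Fin g ⊕ Fin g) finAdeleQ) : Matrix (Fin g ⊕ Fin g) (Fin g ⊕ Fin g) finAdeleQ) =
      c.cmRecipMatrix Φ' E s :=
  coe_auxToGspFin_eq_cmRepMatrix F b h0 h1 c hact r d hd t _ (hN _ (by decide)) (hN _ (by decide)) (hN _ (by decide)) hN₂

end Recip

/-! ### §5. The `hact` bridge: a CM structure PINNED on the frame vectors (A-p04's (A2) ★ `exists_cmStructure_of_orthogonal`) is frame-diagonal -/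

section Pinned

variable {L : Type} [Field L] {M : Type} [Field M] [NumberField M] [IsCMField M]
  {j : L →+* M} {H : Matrix (Fin 3) (Fin 3) L} {ξ₀ ξ : M} {g : ℕ} {δ : Fin g → ℕ}

/-- **Bridge to `hact`.**  If a CM structure `c` indexed by `Fin 1 ⊕ Fin 3` with all fields `M` acts — transported through the
symplectic frame `β` — on the `p`-th FRAME VECTOR `diag(1, B)·e_p` of `W₀ ⊕ V_M` by the scalar `x p` (the pinned specification of
A-p04's ★ `exists_cmStructure_of_orthogonal`: `act x (β(m·b_p)) = β((x_p·m)·b_p)`), then its action read in the standard basis is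
`β`-conjugate to the frame-diagonal matrix: `actMatrix x = P · Res_{M/ℚ}(diag(x₀, B·diag(x₁,x₂,x₃)·B⁻¹)) · Q` — the hypothesis `hact`
of `cmRepMatrix_eq_frame` / `coe_auxToGspFin_eq_cmRepMatrix`.  (The frame vectors `m·b_p` span `M^{1⊕3}` over `ℚ`, both sides are
`ℚ`-linear, and `diag(x₀, B·diag(x₁,x₂,x₃)·B⁻¹) = diag(1,B)·diag(x)·diag(1,B)⁻¹` multiplies `b_p` by `x_p`.)
[cite: Deligne1971TravauxShimura, 4.9 p. 147 and 4.18 p. 150] [cite: Deligne1979ShimuraVarieties, Prop. 2.3.10] -/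
theorem actMatrix_eq_frame_of_pinned (F : SymplecticFrame M j H ξ₀ ξ g δ) (B : GL (Fin 3) M)
    (c : CMStructure g δ (Fin 1 ⊕ Fin 3) (fun _ => M))
    (hpin : ∀ (x : Fin 1 ⊕ Fin 3 → M) (p : Fin 1 ⊕ Fin 3) (m : M),
      c.act x (F.β (m • (blockGL M (1, B)).val *ᵥ Pi.single p 1)) =
        F.β ((x p * m) • (blockGL M (1, B)).val *ᵥ Pi.single p 1))
    (x : Fin 1 ⊕ Fin 3 → M) :
    c.actMatrix x =
      frameP F * resMatrix (ratBasis M)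
        (Matrix.fromBlocks (Matrix.diagonal fun _ : Fin 1 => x (Sum.inl 0)) 0 0
          ((B : Matrix (Fin 3) (Fin 3) M) * Matrix.diagonal (fun k => x (Sum.inr k)) *
            ((B⁻¹ : GL (Fin 3) M) : Matrix (Fin 3) (Fin 3) M))) * frameQ F := by
  classical
  set P : GL (Fin 1 ⊕ Fin 3) M := blockGL M (1, B) with hP
  set D : Matrix (Fin 1 ⊕ Fin 3) (Fin 1 ⊕ Fin 3) M :=
    Matrix.fromBlocks (Matrix.diagonal fun _ : Fin 1 => x (Sum.inl 0)) 0 0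
      ((B : Matrix (Fin 3) (Fin 3) M) * Matrix.diagonal (fun k => x (Sum.inr k)) *
        ((B⁻¹ : GL (Fin 3) M) : Matrix (Fin 3) (Fin 3) M)) with hD
  -- (1) `D = P · diag(x) · P⁻¹` with `P = diag(1, B)`
  have hPval : P.val = Matrix.fromBlocks 1 0 0 (B : Matrix (Fin 3) (Fin 3) M) := by
    rw [hP, coe_blockGL, Units.val_one, one_smul, one_smul]
  have hPinv : (P⁻¹).val = Matrix.fromBlocks 1 0 0 ((B⁻¹ : GL (Fin 3) M) : Matrix (Fin 3) (Fin 3) M) := by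
    rw [hP, ← map_inv, Prod.inv_mk, inv_one, coe_blockGL, Units.val_one, one_smul, one_smul]
  have hx₀ : (fun _ : Fin 1 => x (Sum.inl 0)) = x ∘ Sum.inl := by
    funext i; rw [Function.comp_apply, Fin.fin_one_eq_zero i]
  have hDP : D = P.val * Matrix.diagonal x * (P⁻¹).val := by
    rw [hPval, hPinv, ← Sum.elim_comp_inl_inr x, ← Matrix.fromBlocks_diagonal, Matrix.fromBlocks_multiply,
      Matrix.fromBlocks_multiply, hD, hx₀]
    simp
    rfl
  -- (2) `D` multiplies the `p`-th frame vector by `x p`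
  have hDvec : ∀ p : Fin 1 ⊕ Fin 3, D *ᵥ (P.val *ᵥ Pi.single p 1) = x p • (P.val *ᵥ Pi.single p 1) := by
    intro p
    rw [hDP, Matrix.mulVec_mulVec, Matrix.mul_assoc, ← Units.val_mul, inv_mul_cancel, Units.val_one, Matrix.mul_one,
      ← Matrix.mulVec_mulVec, Matrix.diagonal_mulVec_single, mul_one, ← mul_one (x p), ← smul_eq_mul,
      Pi.single_smul, Matrix.mulVec_smul, smul_eq_mul, mul_one]
  -- (3) the two `ℚ`-linear actions agree on `M^{1⊕3}` (the frame vectors `m·b_p` span it)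
  have hsumD : ∀ f : Fin 1 ⊕ Fin 3 → (Fin 1 ⊕ Fin 3 → M), D *ᵥ (∑ p, f p) = ∑ p, D *ᵥ f p := fun f => by
    simpa only [Matrix.mulVecLin_apply] using map_sum (Matrix.mulVecLin D) f Finset.univ
  have hsumP : ∀ f : Fin 1 ⊕ Fin 3 → (Fin 1 ⊕ Fin 3 → M), P.val *ᵥ (∑ p, f p) = ∑ p, P.val *ᵥ f p := fun f => by
    simpa only [Matrix.mulVecLin_apply] using map_sum (Matrix.mulVecLin P.val) f Finset.univ
  have hagree : ∀ w : Fin 1 ⊕ Fin 3 → M, c.act x (F.β w) = F.β (D *ᵥ w) := by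
    intro w
    have hw : w = ∑ p, ((P⁻¹).val *ᵥ w) p • (P.val *ᵥ Pi.single p (1 : M)) := by
      calc w = P.val *ᵥ ((P⁻¹).val *ᵥ w) := by
            rw [Matrix.mulVec_mulVec, ← Units.val_mul, mul_inv_cancel, Units.val_one, Matrix.one_mulVec]
        _ = P.val *ᵥ (∑ p, ((P⁻¹).val *ᵥ w) p • Pi.single p (1 : M)) := by
            congr 1
            conv_lhs => rw [← Finset.univ_sum_single ((P⁻¹).val *ᵥ w)]
            refine Finset.sum_congr rfl fun p _ => ?_
            rw [← Pi.single_smul, smul_eq_mul, mul_one]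
        _ = ∑ p, ((P⁻¹).val *ᵥ w) p • (P.val *ᵥ Pi.single p 1) := by
            rw [hsumP]
            refine Finset.sum_congr rfl fun p _ => ?_
            rw [Matrix.mulVec_smul]
    rw [hw, map_sum, map_sum, hsumD, map_sum]
    refine Finset.sum_congr rfl fun p _ => ?_
    rw [hpin x p, Matrix.mulVec_smul, hDvec p, smul_smul, mul_comm]
  -- (4) hence the linear maps, hence the matrices, agree
  have hlin : c.act x =
      F.β.toLinearMap ∘ₗ ((Matrix.mulVecLin D).restrictScalars ℚ) ∘ₗ F.β.symm.toLinearMap := by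
    refine LinearMap.ext fun v => ?_
    rw [LinearMap.comp_apply, LinearMap.comp_apply, LinearEquiv.coe_toLinearMap, LinearEquiv.coe_toLinearMap,
      LinearMap.coe_restrictScalars, Matrix.mulVecLin_apply, ← hagree, LinearEquiv.apply_symm_apply]
  rw [CMStructure.actMatrix_def, hlin, ← LinearMap.toMatrix_eq_toMatrix',
    LinearMap.toMatrix_comp (Pi.basisFun ℚ (Fin g ⊕ Fin g)) (resBasis (m := Fin 1 ⊕ Fin 3) (ratBasis M))
      (Pi.basisFun ℚ (Fin g ⊕ Fin g)),
    LinearMap.toMatrix_comp (Pi.basisFun ℚ (Fin g ⊕ Fin g)) (resBasis (m := Fin 1 ⊕ Fin 3) (ratBasis M))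
      (resBasis (m := Fin 1 ⊕ Fin 3) (ratBasis M)),
    toMatrix_resBasis_mulVecLin, Matrix.mul_assoc]
  rfl

end Pinned

/-! ### §6. The reflex-norm swap in the receptacle's spelling: `N_{E,Φ^τ̄}(s) = N_{E,Φ}(s) · ĵ(recipFactor (N_{E/L} s))` -/

section Swap

open NumberField.ComplexEmbedding Literature.NumberTheory.ComplexMultiplication
open Literature.NumberTheory.AdelicBaseChange (finiteIdeleRelNorm)

/-- **S4b-2 in the receptacle's vocabulary** (the `hN₂` input of `coe_auxToGspFin_eq_cmRecipMatrix`): for an embedding of CM fields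
`j : L → M`, a number field `E ⊂ ℂ` which is an `L`-algebra through `τ : L → ℂ` (`hτ`), a `τ`-adapted CM type `Φ` of `M`
(`IsExtAdapted`: `ρ∘j = τ → ρ ∈ Φ`) with `τ`-swap `Ψ` (`ρ ∈ Ψ ↔ (ρ ∈ Φ ∧ ρ∘j ≠ τ) ∨ ρ∘j = τ̄`, A-p04's `exists_cmType_swap`) and
`E ⊇ E*(Φ), E*(Ψ)`: on finite idèles `N_{E,Ψ}(s) = N_{E,Φ}(s) · ĵ(recipFactor L (N_{E/L} s))`, where ★ `recipFactor L N′ = c(N′)·N′⁻¹`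
([Milne2005ShimuraVarieties] (60)–(61), `μ = [τ̄] − [τ]`) and `ĵ = e_M ∘ finAdeleToTensor M j` — ★ `reflexNormFiniteIdele_swap_tau`
(`Literature/NumberTheory/ComplexMultiplication/ReflexNormSwap`) with ★ `finiteAdeleComplexConj_eq_conjFiniteAdele`; `M/L` and `E/L` are
finite because `M`, `E` are number fields (`Module.Finite.of_restrictScalars_finite ℚ`).
[cite: Milne2005ShimuraVarieties, Def. 12.5 p. 113, Def. 12.8 (60)–(62) p. 114] [cite: MilneCM2006, Ch. I §1 Rem. 1.24 (b), Rem. 1.25] -/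
theorem reflexNormFiniteIdele_swap_recipFactor {L : Type} [Field L] [NumberField L] [IsCMField L]
    (M : Type) [Field M] [NumberField M] [IsCMField M] (j : L →+* M) (Φ Ψ : CMType M)
    (E : IntermediateField ℚ ℂ) [NumberField ↥E] [Algebra L ↥E] (τ : L →+* ℂ)
    (hτ : ∀ x : L, ((algebraMap L ↥E x : ↥E) : ℂ) = τ x) (hΦE : traceField Φ ≤ E) (hΨE : traceField Ψ ≤ E)
    (hΦτ : ∀ ρ : M →+* ℂ, ρ.comp j = τ → ρ ∈ Φ.1)
    (hΨ : ∀ ρ : M →+* ℂ, ρ ∈ Ψ.1 ↔ (ρ ∈ Φ.1 ∧ ρ.comp j ≠ τ) ∨ ρ.comp j = conjugate τ)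
    (s : (FiniteAdeleRing (𝓞 ↥E) ↥E)ˣ) :
    ((reflexNormFiniteIdele M Ψ E s : (FiniteAdeleRing (𝓞 M) M)ˣ) : FiniteAdeleRing (𝓞 M) M) =
      ((reflexNormFiniteIdele M Φ E s : (FiniteAdeleRing (𝓞 M) M)ˣ) : FiniteAdeleRing (𝓞 M) M) *
        ratFiniteAdeleTensorEquiv M (finAdeleToTensor M j (recipFactor L (finiteIdeleRelNorm L ↥E s))) := by
  letI : Algebra L M := j.toAlgebra
  haveI : IsScalarTower ℚ L M :=
    IsScalarTower.of_algebraMap_eq fun q => by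
      rw [RingHom.algebraMap_toAlgebra, eq_ratCast, eq_ratCast, map_ratCast]
  haveI : Module.Finite L M := Module.Finite.of_restrictScalars_finite ℚ L M
  haveI : IsScalarTower ℚ L ↥E :=
    IsScalarTower.of_algebraMap_eq fun q => by rw [eq_ratCast, eq_ratCast, map_ratCast]
  haveI : Module.Finite L ↥E := Module.Finite.of_restrictScalars_finite ℚ L ↥E
  rw [reflexNormFiniteIdele_swap_tau M Φ Ψ E τ hτ hΦE hΨE hΦτ hΨ s, recipFactor,
    ← finiteAdeleComplexConj_eq_conjFiniteAdele]
  rfl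

end Swap

end Aux

end UnitaryCanonicalModel

end Literature.AlgebraicGeometry.ShimuraVarieties

end
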